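import Summits.Ventures.CertifiedManyBodySolver.Downfold.EmeryAffineBandSeam
import Literature.MathematicalPhysics.QuantumLattice.EmeryThreeBandFillingConvexity
import HarnessLib

/-!
# AFFINE BANDS AT FILLING: on a DOPED three-band box the cap is the filling-chord of two Rayleigh planes and the vertex floors are
# affine in the filling — the door for function-valued two-sided words `C(q, ρ) − w ≤ e(q, ρ) ≤ C(q, ρ)` on (parameter box) × (filling interval)

Venture CertifiedManyBodySolver, crew hubbard-fast S2 (iv) «three-band Emery boxes», seat hubbard-box-p2 (g16; device «KLDL-V»); namespace
`Summit.Ventures.CertifiedManyBodySolver.Downfold`. Sequel of `EmeryAffineBandSeam` (fixed filling) and box-p1's `EmeryThreeBandFillingConvexity`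
(`emeryEnergyDensity_le_chord_of_caps`). Everything here is PROVED; no number about a material.

THE SHAPE. Two KLDL-R planes at fillings `ρ₁ < ρ₂` (unit `N₁`- and `N₂`-particle `Cu₄O₈` vectors): `e(θ, ρ_i) ≤ Σ_a θ_a T_i a` at every `θ`. Filling convexity
gives, for `ρ ∈ [ρ₁, ρ₂]`, the CHORD PLANE `e(θ, ρ) ≤ Σ_a θ_a · chordDir(ρ)_a`, `chordDir(ρ) = T₁ + (T₂ − T₁)(ρ − ρ₁)/(ρ₂ − ρ₁)` — again affine in `θ`
(`emeryEnergyDensity_le_chordPlane`). So at each fixed `ρ` the fixed-filling door applies: vertex slacks `≤ w` at the `2^|κ|` corners of the parameter box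
⇒ the band `C(q, ρ) − w ≤ e ≤ C(q, ρ)` at every `q` of the box (`emeryEnergyDensity_line_mem_chordBand_of_corners`). The consumer discharges the vertex
slacks for ALL `ρ` of the material's filling interval from each vertex's filling-affine kernel floor `q₀/8 − μρ ≤ e(v, ρ)` (`…_floorAt`): slack and floor
are both affine in `ρ`, so `linarith` from the interval ends suffices (no lemma needed). `holdsOn_emeryEnergyChordBandAtFilling` is the typed-box form:
the band holds at every parameter vector AT ITS OWN CELL FILLING `emeryCellFilling p` whenever the box's filling interval sits inside `[ρ₁, ρ₂]`.

HONEST FRAMING: a door; energy words of the decorated model only; not a superconductivity verdict; no number of record moves.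
-/

noncomputable section

namespace Summit.Ventures.CertifiedManyBodySolver.Downfold

open Finset Literature.MathematicalPhysics.QuantumLattice
open scoped BigOperators

/-- **The chord of two affine caps is an affine cap at every intermediate filling.** [cite: Ruelle1969, §3.3] [cite: Israel1979, Thm. I.3.4] -/
theorem emeryEnergyDensity_le_chordPlane {ρ₁ ρ₂ : ℝ} (h0 : 0 ≤ ρ₁) (h12 : ρ₁ < ρ₂) (h2 : ρ₂ ≤ 3 / 2) {T₁ T₂ : Fin 14 → ℝ}
    (hcap₁ : ∀ θ : Fin 14 → ℝ, emeryEnergyDensity θ ρ₁ ≤ ∑ a, θ a * T₁ a)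
    (hcap₂ : ∀ θ : Fin 14 → ℝ, emeryEnergyDensity θ ρ₂ ≤ ∑ a, θ a * T₂ a) {ρ : ℝ} (hlo : ρ₁ ≤ ρ) (hhi : ρ ≤ ρ₂) :
    ∀ θ : Fin 14 → ℝ, emeryEnergyDensity θ ρ ≤ ∑ a, θ a * (T₁ a + (T₂ a - T₁ a) * ((ρ - ρ₁) / (ρ₂ - ρ₁))) := by
  intro θ
  have h := emeryEnergyDensity_le_chord_of_caps θ h0 h12 h2 (hcap₁ θ) (hcap₂ θ) hlo hhi
  refine h.trans (le_of_eq ?_)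
  have hsplit : ∑ a, θ a * (T₁ a + (T₂ a - T₁ a) * ((ρ - ρ₁) / (ρ₂ - ρ₁))) =
      ∑ a, θ a * T₁ a + (∑ a, θ a * T₂ a - ∑ a, θ a * T₁ a) * ((ρ - ρ₁) / (ρ₂ - ρ₁)) := by
    rw [← Finset.sum_sub_distrib, Finset.sum_mul, ← Finset.sum_add_distrib]
    exact Finset.sum_congr rfl fun a _ => by ring
  rw [hsplit, mul_div_assoc]

/-- **CHORD BAND at one filling (vertex form).** Two global affine caps at `ρ₁ < ρ₂`, a filling `ρ ∈ [ρ₁, ρ₂]`, and vertex slacks `≤ w` of the chord plane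
at the `2^6` (or fewer) vertices of a six-box ⇒ `C(q, ρ) − w ≤ e(emeryLine s q, ρ) ≤ C(q, ρ)` on the whole box, `C(q, ρ) = Σ_k q_k · lineCoeff s (chordDir ρ) k`.
[cite: Rockafellar1970, Thm 32.2] [cite: Ruelle1969, §3.3] -/
theorem emeryEnergyDensity_line_mem_chordBand (s : Fin 4 → ℝ) {ρ₁ ρ₂ : ℝ} (h0 : 0 ≤ ρ₁) (h12 : ρ₁ < ρ₂) (h2 : ρ₂ ≤ 3 / 2)
    {T₁ T₂ : Fin 14 → ℝ} (hcap₁ : ∀ θ : Fin 14 → ℝ, emeryEnergyDensity θ ρ₁ ≤ ∑ a, θ a * T₁ a)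
    (hcap₂ : ∀ θ : Fin 14 → ℝ, emeryEnergyDensity θ ρ₂ ≤ ∑ a, θ a * T₂ a) {ρ : ℝ} (hlo : ρ₁ ≤ ρ) (hhi : ρ ≤ ρ₂)
    (lo hi : Fin 6 → ℝ) {w : ℝ}
    (hw : ∀ v ∈ Fintype.piFinset (fun k => ({lo k, hi k} : Finset ℝ)),
      ∑ k, v k * lineCoeff s (fun a => T₁ a + (T₂ a - T₁ a) * ((ρ - ρ₁) / (ρ₂ - ρ₁))) k - w ≤ emeryEnergyDensity (emeryLine s v) ρ)
    {q : Fin 6 → ℝ} (hq : q ∈ Set.Icc lo hi) :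
    ∑ k, q k * lineCoeff s (fun a => T₁ a + (T₂ a - T₁ a) * ((ρ - ρ₁) / (ρ₂ - ρ₁))) k - w ≤ emeryEnergyDensity (emeryLine s q) ρ ∧
      emeryEnergyDensity (emeryLine s q) ρ ≤ ∑ k, q k * lineCoeff s (fun a => T₁ a + (T₂ a - T₁ a) * ((ρ - ρ₁) / (ρ₂ - ρ₁))) k :=
  emeryEnergyDensity_line_mem_affineBand s (emeryEnergyDensity_le_chordPlane h0 h12 h2 hcap₁ hcap₂ hlo hhi) lo hi hw hq

/-- **CHORD BAND at one filling, named-corner form** (the 64 corner slacks by name). [cite: Rockafellar1970, Thm 32.2] [cite: Ruelle1969, §3.3] -/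
theorem emeryEnergyDensity_line_mem_chordBand_of_corners (s : Fin 4 → ℝ) {ρ₁ ρ₂ : ℝ} (h0 : 0 ≤ ρ₁) (h12 : ρ₁ < ρ₂) (h2 : ρ₂ ≤ 3 / 2)
    {T₁ T₂ : Fin 14 → ℝ} (hcap₁ : ∀ θ : Fin 14 → ℝ, emeryEnergyDensity θ ρ₁ ≤ ∑ a, θ a * T₁ a)
    (hcap₂ : ∀ θ : Fin 14 → ℝ, emeryEnergyDensity θ ρ₂ ≤ ∑ a, θ a * T₂ a) {ρ : ℝ} (hlo : ρ₁ ≤ ρ) (hhi : ρ ≤ ρ₂)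
    (lo hi : Fin 6 → ℝ) {w : ℝ}
    (hw : ∀ a ∈ ({lo 0, hi 0} : Finset ℝ), ∀ b ∈ ({lo 1, hi 1} : Finset ℝ), ∀ c ∈ ({lo 2, hi 2} : Finset ℝ),
      ∀ d ∈ ({lo 3, hi 3} : Finset ℝ), ∀ e ∈ ({lo 4, hi 4} : Finset ℝ), ∀ f ∈ ({lo 5, hi 5} : Finset ℝ),
      ∑ k, (![a, b, c, d, e, f] : Fin 6 → ℝ) k * lineCoeff s (fun a => T₁ a + (T₂ a - T₁ a) * ((ρ - ρ₁) / (ρ₂ - ρ₁))) k - w ≤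
        emeryEnergyDensity (emeryLine s ![a, b, c, d, e, f]) ρ)
    {q : Fin 6 → ℝ} (hq : q ∈ Set.Icc lo hi) :
    ∑ k, q k * lineCoeff s (fun a => T₁ a + (T₂ a - T₁ a) * ((ρ - ρ₁) / (ρ₂ - ρ₁))) k - w ≤ emeryEnergyDensity (emeryLine s q) ρ ∧
      emeryEnergyDensity (emeryLine s q) ρ ≤ ∑ k, q k * lineCoeff s (fun a => T₁ a + (T₂ a - T₁ a) * ((ρ - ρ₁) / (ρ₂ - ρ₁))) k :=
  emeryEnergyDensity_line_mem_affineBand_of_corners s (emeryEnergyDensity_le_chordPlane h0 h12 h2 hcap₁ hcap₂ hlo hhi) lo hi hw hq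

/-- **The line coefficients of the chord direction are the chord of the line coefficients** (both are linear in the direction data). [folklore] -/
theorem lineCoeff_chordDir (s : Fin 4 → ℝ) (T₁ T₂ : Fin 14 → ℝ) (t : ℝ) (k : Fin 6) :
    lineCoeff s (fun a => T₁ a + (T₂ a - T₁ a) * t) k = lineCoeff s T₁ k + (lineCoeff s T₂ k - lineCoeff s T₁ k) * t := by
  fin_cases k <;> simp [lineCoeff] <;> ring

/-- **THE AT-FILLING CHORD-BAND DOOR on a typed Emery box.** Entries `t_pd, t_pp, Delta_pd, U_dd, U_pp, n_holes`, reference level `εp`; two global affine caps at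
fillings `ρ₁ < ρ₂` with the box's filling interval `[(6 − nH.hi)/4, (6 − nH.lo)/4] ⊆ [ρ₁, ρ₂]`; and, for EVERY filling `ρ` of that interval, vertex slacks `≤ w`
of the chord plane at the vertices of the delivered six-box. Then at every parameter vector `p`, AT ITS OWN CELL FILLING,
`C(q(p), ρ(p)) − w ≤ e(emeryLine s q(p), ρ(p)) ≤ C(q(p), ρ(p))`. [cite: Rockafellar1970, Thm 32.2] [cite: Ruelle1969, §3.3] [cite: Israel1979, Thm. I.3.4] -/
theorem holdsOn_emeryEnergyChordBandAtFilling {E : EmeryBox} {eA eB eD eUd eUp eN : Entry} {εp : ℚ}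
    (hA : E .tpd = some eA) (hB : E .tpp = some eB) (hD : E .DeltaPd = some eD)
    (hUd : E .Udd = some eUd) (hUp : E .Upp = some eUp) (hN : E .nHoles = some eN) (s : Fin 4 → ℝ)
    {ρ₁ ρ₂ : ℝ} (h0 : 0 ≤ ρ₁) (h12 : ρ₁ < ρ₂) (h2 : ρ₂ ≤ 3 / 2)
    (hρlo : ρ₁ ≤ ((((6 : ℚ) - eN.encl.snd) / 4 : ℚ) : ℝ)) (hρhi : ((((6 : ℚ) - eN.encl.fst) / 4 : ℚ) : ℝ) ≤ ρ₂)
    {T₁ T₂ : Fin 14 → ℝ} (hcap₁ : ∀ θ : Fin 14 → ℝ, emeryEnergyDensity θ ρ₁ ≤ ∑ a, θ a * T₁ a)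
    (hcap₂ : ∀ θ : Fin 14 → ℝ, emeryEnergyDensity θ ρ₂ ≤ ∑ a, θ a * T₂ a) {w : ℝ}
    (hw : ∀ ρ : ℝ, ((((6 : ℚ) - eN.encl.snd) / 4 : ℚ) : ℝ) ≤ ρ → ρ ≤ ((((6 : ℚ) - eN.encl.fst) / 4 : ℚ) : ℝ) →
      ∀ v ∈ Fintype.piFinset
        (fun k => ({emeryLo εp eA eB eD eUd eUp k, emeryHi εp eA eB eD eUd eUp k} : Finset ℝ)),
      ∑ k, v k * lineCoeff s (fun a => T₁ a + (T₂ a - T₁ a) * ((ρ - ρ₁) / (ρ₂ - ρ₁))) k - w ≤ emeryEnergyDensity (emeryLine s v) ρ) :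
    HoldsOn (fun p : EmeryCoord → ℝ =>
      ∑ k, emeryLineCoords (εp : ℝ) p k *
            lineCoeff s (fun a => T₁ a + (T₂ a - T₁ a) * ((emeryCellFilling p - ρ₁) / (ρ₂ - ρ₁))) k - w ≤
          emeryEnergyDensity (emeryLine s (emeryLineCoords (εp : ℝ) p)) (emeryCellFilling p) ∧
        emeryEnergyDensity (emeryLine s (emeryLineCoords (εp : ℝ) p)) (emeryCellFilling p) ≤
          ∑ k, emeryLineCoords (εp : ℝ) p k *
            lineCoeff s (fun a => T₁ a + (T₂ a - T₁ a) * ((emeryCellFilling p - ρ₁) / (ρ₂ - ρ₁))) k) E := by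
  intro p hp
  have hρ := emeryCellFilling_mem_Icc hN hp
  exact emeryEnergyDensity_line_mem_chordBand s h0 h12 h2 hcap₁ hcap₂ (hρlo.trans hρ.1) (hρ.2.trans hρhi) _ _
    (hw _ hρ.1 hρ.2) (emeryLineCoords_mem_Icc hA hB hD hUd hUp hp)

end Summit.Ventures.CertifiedManyBodySolver.Downfold

end
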